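import Summits.ABC.ABC.Theses.RibetTakahashiSplit
import Literature.NumberTheory.EllipticCurves.LFunctionCoefficientBound

/-!
# Line `hasse-pinning-fixed-level` for crux `FewPrimeValuationProduct` (stmt-ABC-1563) — skeleton

Crux (route `RibetTakahashiSplit`, r4): for every `ε > 0` there is `C` with
`T(E) := ∏_{p ∥ N} ord_p Δ_min(E) ≤ C · N^ε` for every elliptic `E/ℚ` semistable away from `2`
(`p² ∤ N` for odd `p`) with at most `3` odd multiplicative primes.

Idea card `Ideas/hasse-pinning-fixed-level.md` (triage r1 ×3: pass). Write `c_p := ord_p Δ_min` and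
call a COMMON divisor `d` of all the `c_p` (`p` multiplicative) a DEPTH of `E`. The line splits the
crux into two halves of different nature and certifies the glue:

* PAIR half (the sibling card `switching-triangle`, Pasten's switch-on-`D` lemma): for two
  multiplicative primes `p ≠ q`, `c_p c_q ≤ K_ε N^ε · gcd(c_p, c_q)²` (`stub_pairSwitching`); by the
  switching triangle/tetrahedron (PROVED here: `switch_step`, `pair_le_of_pairwise`,
  `prod_le_of_pairwise`) this bounds `T(E)` by `(K N^ε)^16 · G⁸`, `G` the depth `gcd_p c_p`.
* DEPTH half (this card's lever): a depth `ℓ^m` makes `E[ℓ^m]` unramified at every multiplicative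
  prime, hence (minimal/`Σ = {2}` `R = 𝕋` at the fixed level `2^e`, `ℓ ≥ ℓ₀`) congruent mod `ℓ^m` to
  one of FINITELY MANY FIXED curves `E₀` of `2`-power conductor (`stub_fixedLevelCongruence`); a good
  prime `v ≤ C N^ε` with `a_v(E) ≠ a_v(E₀)` (`stub_leastDistinguishingPrime`, the card's Transfer C⁺,
  the Linnik wall) then PINS the depth: all prime powers with the same partner divide the non-zero
  integer `a_v(E) − a_v(E₀)`, of size `≤ 4√v` by Hasse (in tree: `abs_LFunction_prime_pow_le`);
  primes `ℓ < ℓ₀` carry bounded depth (`stub_smallPrimeDepth`, Pasten L.6.10 = Darmon–Granville).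
  The aggregation `depthBound_of` (partnerwise CRT-free product + Hasse) is PROVED here.

`of_parts : stub₁-statement → stub₂-statement → stub₃-statement → stub₄-statement → (crux unfolded)`
is the sorry-free composition and `FewPrimeValuationProduct_of : FewPrimeValuationProduct :=
of_parts stub_pairSwitching … stub_smallPrimeDepth` concludes the route decl BY NAME; `sorry` occurs
only in the four `stub_*` theorems.

Frobenius traces are typed through Mathlib's `WeierstrassCurve.LFunction : ArithmeticFunction ℤ`
(`a_v(E) = W.LFunction v` at a good prime `v`, model-independent: the local factor is computed on
the minimal model), so no modular-form object enters the file.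

Disproof used (`Cruxes/FewPrimeValuationProduct/Disproof.lean`, cdisprove): it contains NO
`_false_without_` theorem; `not_fewPrimeBound_zero` (ε cannot be dropped; Chen/Mersenne–Frey
families with the exponent at the prime `2`, `c₂ = 2n − 8`) is honoured — every stub keeps `N^ε`
or is a per-prime finiteness statement, and `c₂` (when `2 ∥ N`) is a multiplicative exponent handled
by the pair half exactly like the odd ones (Pasten `S = ∅`, `D = 2p`); `not_fewPrime_le_conductor`,
`fewPrimeBound_zero_const_ge` (no uniform/explicit constant is claimed: `ℓ₀`, `B(ℓ)`, `C` are
ineffective); `fewPrimeValuationProduct_of_szpiro` (consistency: Szpiro ⟹ stubs 1 and the depth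
bound). Negatives index (`ledger negatives --problem ABC`): unrelated (GlobalQuasiLogDerivative,
BelyiSqueeze).
-/

-- `Summit.<Summit>.<Problem>`: for the single-conjunct summit `ABC` the duplicate `ABC.ABC` is mandated.
set_option linter.dupNamespace false

noncomputable section

namespace Summit.ABC.ABC.Cruxes.FewPrimeValuationProduct.HassePinningFixedLevel

open scoped BigOperators

/-! ## Registered stubs

Notation in the docstrings: `N = W.conductorNorm ℤ`; the multiplicative primes of `W` are
`Mult(W) = {p ∣ N prime : p² ∤ N}` (for `W` semistable away from `2` these are all bad primes except
possibly `2`); `c_p = (W.minimalDiscriminantNorm ℤ).factorization p = ord_p Δ_min`;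
`a_v(W) = W.LFunction v`. Every stub carries the crux's hypothesis block (H_sf: `p² ∤ N` for odd `p`;
H_card: `≤ 3` odd multiplicative primes) and, where a junk value `c_p = 0` would bite, the
positivity `0 < c_p` on `Mult(W)` (true for elliptic `W`; supplied by the glue by a case split). -/

/-- **stub 1 — pair switching bound** (the sibling card `switching-triangle`'s load, in arithmetic
form; shared with that line). For `E` in the class and two distinct multiplicative primes `p ≠ q`
(the prime `2` included when `2 ∥ N`): `c_p · c_q ≤ K_ε · N^ε · gcd(c_p, c_q)²` (under the
positivity of all `c_r`, `r` multiplicative — automatic for elliptic `W`, it only removes junk; with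
it the stub is IMPLIED by the crux: certificate `pairSwitching_of_fewPrime` below).
In print this is [PairwiseRT] `c_p c_q ≤ K₀ · R_{pq} · gcd(c_p,c_q)²` with
`R_{pq} = δ_{1,N}/δ_{pq,N/pq}` the two-prime Shimura degree ratio (PastenShimura2024 =
arXiv:1705.09251: Prop 6.13 = Ribet–Takahashi Thm 2 with `d = 1`, L.6.8 isogeny fudge, L.6.14
Eisenstein image, L.6.15 switch on `D` — no hypothesis on `M`; L.6.18 for the prime `2`, `S = ∅`)
TIMES the open input [TwoPrimeEigenformLowerBound] `R_{pq} ≤ C_ε N^ε`, i.e. the route's r2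
mechanism `‖f_{pq,M}‖² ≥ N^{1−o(1)}` (item stmt-ABC-1755, Pasten Conj. 1.14 strength) at
`(D, M) = (pq, N/pq)`. Why plausibly true: implied by Szpiro (`c_p ≤ 7 log₂ N + O(1)`), by the crux
itself on the class, and at exponent `16/3 + ε` (times `M²`) unconditionally by Pasten Thm 14.1.
Why it might fail as a LINE: route kill criterion (iii) (a Kodaira–Spencer defect ≍ a power of `p`
per prime of `DM`). Size XL / OPEN. -/
theorem stub_pairSwitching :
    ∀ ε : ℝ, 0 < ε → ∃ K : ℝ, ∀ (W : WeierstrassCurve ℚ) [W.IsElliptic],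
      (∀ p : ℕ, p.Prime → p ≠ 2 → ¬ p ^ 2 ∣ W.conductorNorm ℤ) →
      ((W.conductorNorm ℤ).primeFactors.filter
        (fun p => p ≠ 2 ∧ ¬ p ^ 2 ∣ W.conductorNorm ℤ)).card ≤ 3 →
      (∀ p ∈ (W.conductorNorm ℤ).primeFactors.filter (fun p => ¬ p ^ 2 ∣ W.conductorNorm ℤ),
        0 < (W.minimalDiscriminantNorm ℤ).factorization p) →
      ∀ p ∈ (W.conductorNorm ℤ).primeFactors.filter (fun p => ¬ p ^ 2 ∣ W.conductorNorm ℤ),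
      ∀ q ∈ (W.conductorNorm ℤ).primeFactors.filter (fun p => ¬ p ^ 2 ∣ W.conductorNorm ℤ),
        p ≠ q →
        (((W.minimalDiscriminantNorm ℤ).factorization p *
            (W.minimalDiscriminantNorm ℤ).factorization q : ℕ) : ℝ) ≤
          K * (W.conductorNorm ℤ : ℝ) ^ ε *
            ((Nat.gcd ((W.minimalDiscriminantNorm ℤ).factorization p)
                ((W.minimalDiscriminantNorm ℤ).factorization q) ^ 2 : ℕ) : ℝ) := by
  sorry

/-- **stub 2 — fixed-level congruence** (the modular heart of the card, step (ii); a THEOREM of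
the literature, to be vendored as a named fact). There are an absolute `ℓ₀` and a FINITE set `S` of
elliptic curves over `ℚ` with good reduction away from `2` and additive reduction at `2` (`4 ∣ N₀`;
in truth: one curve per isogeny class of conductor `32, 64, 128, 256` — Cremona `32a, 64a, 128a–d,
256a–d`; there is no curve of conductor `≤ 16`) such that for every prime
`ℓ ≥ ℓ₀`, `m ≥ 1` and `E` in the class with a depth `ℓ^m ∣ c_p` at EVERY multiplicative `p`, some
`E₀ ∈ S` satisfies `a_v(E) ≡ a_v(E₀) (mod ℓ^m)` at every prime `v ∤ 2N`.
Chain: `ℓ^m ∣ c_p` ⟺ `E[ℓ^m]` unramified at a multiplicative `p ≠ ℓ`, finite flat at `p = ℓ`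
(Tate curve); `ℓ > 163` ⟹ `E[ℓ]` absolutely irreducible (Mazur1978), and `E` semistable at `ℓ`
⟹ the Taylor–Wiles non-degeneracy; `R_Σ = 𝕋_Σ` with `Σ = {2}` (Wiles1995, TaylorWiles1995,
Diamond1996 "On deformation rings and Hecke rings") makes `E[ℓ^m]` a quotient of the Hecke algebra
of weight `2` and level `2^e`, `e ≤ 10`; for `ℓ ≥ ℓ₀` the finitely many eigen-systems of that level
are pairwise incongruent, `ℓ ∤ [O_g : ℤ[a_v(g)]]`, and an irrational partner `g` is excluded on the
class by `ℓ^m ∣ N(a_{v}(E) − a_{v}(g)) ≠ 0` at one of five fixed odd primes `v` with `a_v(g) ∉ ℚ`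
(at most three are bad for `E`, one may equal `ℓ`; this is where H_card enters) — so the partner is
`f_{E₀}`, `E[ℓ^m] ≅ E₀[ℓ^m]` (Carayol), and the traces agree mod `ℓ^m`
at every `v ∤ 2ℓN`, and at `v = ℓ ∤ N` as well (both curves good at `ℓ`; ordinary: unit root mod
`ℓ^m` from the étale quotient, Raynaud `e = 1`; supersingular: `a_ℓ = 0`). Vacuous sub-cases (no
weight-2 forms of level `≤ 16`; `2 ∈ Mult` with `ℓ^m ∣ c₂` ⟹ level `4`) are consistent.
Why it might fail: only through a mis-transcription of the `R = 𝕋` hypotheses at `p = 2`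
(non-minimal at `2` is allowed by `Σ = {2}`; level then `∣ 2^{10}`, still a fixed finite set).
Size L as a vendored fact (+ M of bookkeeping); provable NOW only modulo that fact. -/
theorem stub_fixedLevelCongruence :
    ∃ ℓ₀ : ℕ, ∃ S : Finset (WeierstrassCurve ℚ),
      (∀ W₀ ∈ S, W₀.IsElliptic ∧ (∀ p ∈ (W₀.conductorNorm ℤ).primeFactors, p = 2) ∧
        2 ^ 2 ∣ W₀.conductorNorm ℤ) ∧
      ∀ (ℓ m : ℕ), ℓ.Prime → ℓ₀ ≤ ℓ → 1 ≤ m → ∀ (W : WeierstrassCurve ℚ) [W.IsElliptic],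
        (∀ p : ℕ, p.Prime → p ≠ 2 → ¬ p ^ 2 ∣ W.conductorNorm ℤ) →
        ((W.conductorNorm ℤ).primeFactors.filter
          (fun p => p ≠ 2 ∧ ¬ p ^ 2 ∣ W.conductorNorm ℤ)).card ≤ 3 →
        ((W.conductorNorm ℤ).primeFactors.filter (fun p => ¬ p ^ 2 ∣ W.conductorNorm ℤ)).Nonempty →
        (∀ p ∈ (W.conductorNorm ℤ).primeFactors.filter (fun p => ¬ p ^ 2 ∣ W.conductorNorm ℤ),
          0 < (W.minimalDiscriminantNorm ℤ).factorization p) →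
        (∀ p ∈ (W.conductorNorm ℤ).primeFactors.filter (fun p => ¬ p ^ 2 ∣ W.conductorNorm ℤ),
          ℓ ^ m ∣ (W.minimalDiscriminantNorm ℤ).factorization p) →
        ∃ W₀ ∈ S, ∀ v : ℕ, v.Prime → ¬ v ∣ 2 * W.conductorNorm ℤ →
          ((ℓ ^ m : ℕ) : ℤ) ∣ W.LFunction v - W₀.LFunction v := by
  sorry

/-- **stub 3 — least distinguishing prime** (the card's Transfer C⁺; the Linnik wall; HARDEST own
stub of the line). For a FIXED elliptic `W₀` with good reduction away from `2` and additive
reduction at `2` (`4 ∣ N₀`) and every `ε > 0` there is `C` such that every `E` in the class with at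
least one multiplicative prime (so `N_E ≠ N_{W₀}` — they differ at that prime — hence `E ≁ W₀`,
Faltings–Serre) has a prime `v ∤ 2N_E`, `v ≤ C · N_E^ε`, with `a_v(E) ≠ a_v(W₀)`.
Why EASIER than the crux: a statement about ONE pair of compatible systems with a FIXED partner,
insensitive to the height of `E`; under GRH `v ≪ (log N_E)²` (Serre1981 §8, effective Chebotarev for
`ℚ(E[ℓ], W₀[ℓ])`; or a zero-free region for the Rankin–Selberg `L(f_E × f_{W₀})`), heuristically
`v ≍ log N_E`; unconditionally polynomial (`v ≪ N^{A}`: Sturm at level `lcm(N, 256)` after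
stripping the bad Euler factors, or log-free zero-density/Linnik-type exponents) — the exponent
`A ↦ ε` is exactly what is open (the LINNIK WALL of the card; `Literature.Barriers.ABC.*`: no
catalogued barrier is in this technique class). Why it might fail: it does not fail at truth level
short of a failure of GRH-type expectations; it may fail to be PROVABLE without GRH. Size XL / OPEN
at `N^ε`; M under GRH as a named fact. -/
theorem stub_leastDistinguishingPrime :
    ∀ (W₀ : WeierstrassCurve ℚ) [W₀.IsElliptic],
      (∀ p ∈ (W₀.conductorNorm ℤ).primeFactors, p = 2) → 2 ^ 2 ∣ W₀.conductorNorm ℤ →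
      ∀ ε : ℝ, 0 < ε → ∃ C : ℝ, ∀ (W : WeierstrassCurve ℚ) [W.IsElliptic],
        (∀ p : ℕ, p.Prime → p ≠ 2 → ¬ p ^ 2 ∣ W.conductorNorm ℤ) →
        ((W.conductorNorm ℤ).primeFactors.filter
          (fun p => p ≠ 2 ∧ ¬ p ^ 2 ∣ W.conductorNorm ℤ)).card ≤ 3 →
        ((W.conductorNorm ℤ).primeFactors.filter (fun p => ¬ p ^ 2 ∣ W.conductorNorm ℤ)).Nonempty →
        ∃ v : ℕ, v.Prime ∧ ¬ v ∣ 2 * W.conductorNorm ℤ ∧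
          (v : ℝ) ≤ C * (W.conductorNorm ℤ : ℝ) ^ ε ∧ W.LFunction v ≠ W₀.LFunction v := by
  sorry

/-- **stub 4 — bounded depth at each small prime** (the card's "small / reducible `ℓ` contribute a
bounded factor", triage caveat (c) made precise). For every prime `ℓ` there is `B = B(ℓ)` such that
a depth `ℓ^m ∣ c_p` at every multiplicative `p` of an `E` in the class forces `ℓ^m ≤ B`.
Proof in print: if `ℓ^m ≥ 7` then `Δ_min(E) = ±2^{c₂} · k^{ℓ^m}` (all odd bad primes are
multiplicative), so `E` is one of FINITELY many curves by PastenShimura2024 Lemma 6.10 (`S = {2}`,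
`L = ℓ^m`; `S = ∅` if `2` is itself multiplicative with `ℓ^m ∣ c₂`) = Darmon–Granville finiteness
for `A x^L = y³ − z²` (DarmonGranville1995; ineffective, Faltings); each of them has a finite depth.
For residually reducible `ℓ ≤ 163` a cheaper route is isogeny/Kenku–Mazur bookkeeping plus pinning
at the least good prime `≤ 11` (Pasten L.6.4-type), not needed here.
Why it might fail: it does not at truth level (a theorem); `B(ℓ)` is ineffective. Size M given the
named fact (L.6.10 to be vendored), S of bookkeeping. -/
theorem stub_smallPrimeDepth :
    ∀ ℓ : ℕ, ℓ.Prime → ∃ B : ℝ, ∀ (W : WeierstrassCurve ℚ) [W.IsElliptic],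
      (∀ p : ℕ, p.Prime → p ≠ 2 → ¬ p ^ 2 ∣ W.conductorNorm ℤ) →
      ((W.conductorNorm ℤ).primeFactors.filter
        (fun p => p ≠ 2 ∧ ¬ p ^ 2 ∣ W.conductorNorm ℤ)).card ≤ 3 →
      ((W.conductorNorm ℤ).primeFactors.filter (fun p => ¬ p ^ 2 ∣ W.conductorNorm ℤ)).Nonempty →
      (∀ p ∈ (W.conductorNorm ℤ).primeFactors.filter (fun p => ¬ p ^ 2 ∣ W.conductorNorm ℤ),
        0 < (W.minimalDiscriminantNorm ℤ).factorization p) →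
      ∀ m : ℕ,
        (∀ p ∈ (W.conductorNorm ℤ).primeFactors.filter (fun p => ¬ p ^ 2 ∣ W.conductorNorm ℤ),
          ℓ ^ m ∣ (W.minimalDiscriminantNorm ℤ).factorization p) →
        ((ℓ ^ m : ℕ) : ℝ) ≤ B := by
  sorry

/-! ## Part A — the switching triangle (sorry-free arithmetic) -/

/-- Two divisors of `a > 0` multiply to at most `a` times their gcd. -/
theorem mul_le_mul_gcd_of_dvd {a u w : ℕ} (ha : 0 < a) (hu : u ∣ a) (hw : w ∣ a) :
    u * w ≤ a * Nat.gcd u w := by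
  have hle : Nat.lcm u w ≤ a := Nat.le_of_dvd ha (Nat.lcm_dvd hu hw)
  calc u * w = Nat.gcd u w * Nat.lcm u w := (Nat.gcd_mul_lcm u w).symm
    _ ≤ Nat.gcd u w * a := Nat.mul_le_mul_left _ hle
    _ = a * Nat.gcd u w := Nat.mul_comm _ _

/-- **The switching step.** If `a·b ≤ X u²` and `a·c ≤ X w²` with `u ∣ a`, `w ∣ a`, `a > 0`, then
`b·c ≤ X² · gcd(u, w)²` (multiply, use `u w ≤ a · gcd(u,w)`, cancel `a²`). -/
theorem switch_step {a b c u w : ℕ} {X : ℝ} (hX : 0 ≤ X) (ha : 0 < a) (hu : u ∣ a) (hw : w ∣ a)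
    (h1 : ((a * b : ℕ) : ℝ) ≤ X * ((u ^ 2 : ℕ) : ℝ))
    (h2 : ((a * c : ℕ) : ℝ) ≤ X * ((w ^ 2 : ℕ) : ℝ)) :
    ((b * c : ℕ) : ℝ) ≤ X ^ 2 * ((Nat.gcd u w ^ 2 : ℕ) : ℝ) := by
  have hg' : ((u * w : ℕ) : ℝ) ≤ ((a * Nat.gcd u w : ℕ) : ℝ) := by
    exact_mod_cast mul_le_mul_gcd_of_dvd ha hu hw
  have hprod : ((a * b : ℕ) : ℝ) * ((a * c : ℕ) : ℝ) ≤
      (X * ((u ^ 2 : ℕ) : ℝ)) * (X * ((w ^ 2 : ℕ) : ℝ)) :=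
    mul_le_mul h1 h2 (by positivity) (by positivity)
  have lhs : ((a * b : ℕ) : ℝ) * ((a * c : ℕ) : ℝ) = (a : ℝ) ^ 2 * ((b * c : ℕ) : ℝ) := by
    push_cast; ring
  have rhs : (X * ((u ^ 2 : ℕ) : ℝ)) * (X * ((w ^ 2 : ℕ) : ℝ)) = X ^ 2 * ((u * w : ℕ) : ℝ) ^ 2 := by
    push_cast; ring
  rw [lhs, rhs] at hprod
  have h3 : X ^ 2 * ((u * w : ℕ) : ℝ) ^ 2 ≤ X ^ 2 * ((a * Nat.gcd u w : ℕ) : ℝ) ^ 2 := by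
    apply mul_le_mul_of_nonneg_left _ (by positivity)
    exact pow_le_pow_left₀ (by positivity) hg' 2
  have h4 : (a : ℝ) ^ 2 * ((b * c : ℕ) : ℝ) ≤ (a : ℝ) ^ 2 * (X ^ 2 * ((Nat.gcd u w ^ 2 : ℕ) : ℝ)) := by
    calc (a : ℝ) ^ 2 * ((b * c : ℕ) : ℝ) ≤ X ^ 2 * ((a * Nat.gcd u w : ℕ) : ℝ) ^ 2 := hprod.trans h3
      _ = (a : ℝ) ^ 2 * (X ^ 2 * ((Nat.gcd u w ^ 2 : ℕ) : ℝ)) := by push_cast; ring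
  have ha' : (0 : ℝ) < (a : ℝ) ^ 2 := by positivity
  exact le_of_mul_le_mul_left h4 ha'

/-- **Pair bound from pairwise switching.** On a set `M` of at most four indices with positive
values, the pairwise bounds `c_p c_q ≤ X · gcd(c_p,c_q)²` give `c_p c_q ≤ X⁴ · G²` for every pair,
`G = gcd_{M} c` (triangle: one switching step; tetrahedron: three). -/
theorem pair_le_of_pairwise (M : Finset ℕ) (c : ℕ → ℕ) (X : ℝ) (hX : 1 ≤ X)
    (hcard : M.card ≤ 4) (hpos : ∀ p ∈ M, 0 < c p)
    (hpair : ∀ p ∈ M, ∀ q ∈ M, p ≠ q →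
      ((c p * c q : ℕ) : ℝ) ≤ X * ((Nat.gcd (c p) (c q) ^ 2 : ℕ) : ℝ))
    {p q : ℕ} (hp : p ∈ M) (hq : q ∈ M) (hpq : p ≠ q) :
    ((c p * c q : ℕ) : ℝ) ≤ X ^ 4 * ((M.gcd c ^ 2 : ℕ) : ℝ) := by
  have hG0 : 0 < M.gcd c := Nat.pos_of_ne_zero (by
    rw [Ne, Finset.gcd_eq_zero_iff]; push Not; exact ⟨p, hp, (hpos p hp).ne'⟩)
  have hG : ∀ d : ℕ, (∀ x ∈ M, d ∣ c x) → d ≤ M.gcd c := fun d hd =>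
    Nat.le_of_dvd hG0 (Finset.dvd_gcd hd)
  have hX0 : 0 ≤ X := by linarith
  have hX4 : X ≤ X ^ 4 := by
    calc X = X ^ 1 := (pow_one X).symm
      _ ≤ X ^ 4 := pow_le_pow_right₀ hX (by norm_num)
  have hX24 : X ^ 2 ≤ X ^ 4 := pow_le_pow_right₀ hX (by norm_num)
  set R := (M.erase p).erase q with hR
  have hRcard : R.card ≤ 2 := by
    have h1 : (M.erase p).card = M.card - 1 := Finset.card_erase_of_mem hp
    have hq' : q ∈ M.erase p := Finset.mem_erase.mpr ⟨hpq.symm, hq⟩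
    have h2 : R.card = (M.erase p).card - 1 := Finset.card_erase_of_mem hq'
    omega
  have hRmem : ∀ x, x ∈ R ↔ x ∈ M ∧ x ≠ p ∧ x ≠ q := by
    intro x
    simp only [hR, Finset.mem_erase]
    tauto
  rcases Nat.lt_or_ge R.card 1 with h0 | h1
  · -- `M ⊆ {p, q}`: the edge itself
    have hR0 : R = ∅ := Finset.card_eq_zero.mp (by omega)
    have hsub : ∀ x ∈ M, x = p ∨ x = q := by
      intro x hx
      by_contra h
      push Not at h
      have hxR : x ∈ R := (hRmem x).mpr ⟨hx, h.1, h.2⟩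
      rw [hR0] at hxR
      exact absurd hxR (Finset.notMem_empty x)
    have hg : Nat.gcd (c p) (c q) ≤ M.gcd c := hG _ (fun x hx => by
      rcases hsub x hx with rfl | rfl
      · exact Nat.gcd_dvd_left _ _
      · exact Nat.gcd_dvd_right _ _)
    calc ((c p * c q : ℕ) : ℝ) ≤ X * ((Nat.gcd (c p) (c q) ^ 2 : ℕ) : ℝ) := hpair p hp q hq hpq
      _ ≤ X ^ 4 * ((M.gcd c ^ 2 : ℕ) : ℝ) := by
        apply mul_le_mul hX4 _ (by positivity) (by positivity)
        exact_mod_cast Nat.pow_le_pow_left hg 2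
  · rcases Nat.lt_or_ge R.card 2 with h1' | h2
    · -- `M = {p, q, r}`: one triangle with apex `r`
      have hR1 : R.card = 1 := by omega
      obtain ⟨r, hRr⟩ := Finset.card_eq_one.mp hR1
      have hr : r ∈ M ∧ r ≠ p ∧ r ≠ q :=
        (hRmem r).mp (by rw [hRr]; exact Finset.mem_singleton_self r)
      have hsub : ∀ x ∈ M, x = p ∨ x = q ∨ x = r := by
        intro x hx
        by_cases h : x = p
        · exact Or.inl h
        by_cases h' : x = q
        · exact Or.inr (Or.inl h')
        have hxR : x ∈ R := (hRmem x).mpr ⟨hx, h, h'⟩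
        rw [hRr, Finset.mem_singleton] at hxR
        exact Or.inr (Or.inr hxR)
      have key := switch_step hX0 (hpos r hr.1)
        (Nat.gcd_dvd_left (c r) (c p)) (Nat.gcd_dvd_left (c r) (c q))
        (hpair r hr.1 p hp hr.2.1) (hpair r hr.1 q hq hr.2.2)
      have hg : Nat.gcd (Nat.gcd (c r) (c p)) (Nat.gcd (c r) (c q)) ≤ M.gcd c := hG _ (fun x hx => by
        rcases hsub x hx with rfl | rfl | rfl
        · exact (Nat.gcd_dvd_left _ _).trans (Nat.gcd_dvd_right _ _)
        · exact (Nat.gcd_dvd_right _ _).trans (Nat.gcd_dvd_right _ _)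
        · exact (Nat.gcd_dvd_left _ _).trans (Nat.gcd_dvd_left _ _))
      calc ((c p * c q : ℕ) : ℝ)
          ≤ X ^ 2 * ((Nat.gcd (Nat.gcd (c r) (c p)) (Nat.gcd (c r) (c q)) ^ 2 : ℕ) : ℝ) := key
        _ ≤ X ^ 4 * ((M.gcd c ^ 2 : ℕ) : ℝ) := by
          apply mul_le_mul hX24 _ (by positivity) (by positivity)
          exact_mod_cast Nat.pow_le_pow_left hg 2
    · -- `M = {p, q, r, s}`: two triangles with apex `s`, then one with apex `r`
      have hR2 : R.card = 2 := by omega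
      obtain ⟨r, s, hrs, hRrs⟩ := Finset.card_eq_two.mp hR2
      have hr : r ∈ M ∧ r ≠ p ∧ r ≠ q := (hRmem r).mp (by rw [hRrs]; simp)
      have hs : s ∈ M ∧ s ≠ p ∧ s ≠ q := (hRmem s).mp (by rw [hRrs]; simp)
      have hsub : ∀ x ∈ M, x = p ∨ x = q ∨ x = r ∨ x = s := by
        intro x hx
        by_cases h : x = p
        · exact Or.inl h
        by_cases h' : x = q
        · exact Or.inr (Or.inl h')
        have hxR : x ∈ R := (hRmem x).mpr ⟨hx, h, h'⟩
        rw [hRrs, Finset.mem_insert, Finset.mem_singleton] at hxR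
        rcases hxR with h'' | h''
        · exact Or.inr (Or.inr (Or.inl h''))
        · exact Or.inr (Or.inr (Or.inr h''))
      have t1 := switch_step hX0 (hpos s hs.1)
        (Nat.gcd_dvd_left (c s) (c r)) (Nat.gcd_dvd_left (c s) (c p))
        (hpair s hs.1 r hr.1 hrs.symm) (hpair s hs.1 p hp hs.2.1)
      have t2 := switch_step hX0 (hpos s hs.1)
        (Nat.gcd_dvd_left (c s) (c r)) (Nat.gcd_dvd_left (c s) (c q))
        (hpair s hs.1 r hr.1 hrs.symm) (hpair s hs.1 q hq hs.2.2)
      have key := switch_step (X := X ^ 2) (by positivity) (hpos r hr.1)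
        ((Nat.gcd_dvd_left _ _).trans (Nat.gcd_dvd_right _ _))
        ((Nat.gcd_dvd_left _ _).trans (Nat.gcd_dvd_right _ _)) t1 t2
      have hg : Nat.gcd (Nat.gcd (Nat.gcd (c s) (c r)) (Nat.gcd (c s) (c p)))
          (Nat.gcd (Nat.gcd (c s) (c r)) (Nat.gcd (c s) (c q))) ≤ M.gcd c := hG _ (fun x hx => by
        rcases hsub x hx with rfl | rfl | rfl | rfl
        · exact (Nat.gcd_dvd_left _ _).trans ((Nat.gcd_dvd_right _ _).trans (Nat.gcd_dvd_right _ _))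
        · exact (Nat.gcd_dvd_right _ _).trans ((Nat.gcd_dvd_right _ _).trans (Nat.gcd_dvd_right _ _))
        · exact (Nat.gcd_dvd_left _ _).trans ((Nat.gcd_dvd_left _ _).trans (Nat.gcd_dvd_right _ _))
        · exact (Nat.gcd_dvd_left _ _).trans ((Nat.gcd_dvd_left _ _).trans (Nat.gcd_dvd_left _ _)))
      calc ((c p * c q : ℕ) : ℝ)
          ≤ (X ^ 2) ^ 2 * ((Nat.gcd (Nat.gcd (Nat.gcd (c s) (c r)) (Nat.gcd (c s) (c p)))
              (Nat.gcd (Nat.gcd (c s) (c r)) (Nat.gcd (c s) (c q))) ^ 2 : ℕ) : ℝ) := key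
        _ ≤ (X ^ 2) ^ 2 * ((M.gcd c ^ 2 : ℕ) : ℝ) := by
          apply mul_le_mul_of_nonneg_left _ (by positivity)
          exact_mod_cast Nat.pow_le_pow_left hg 2
        _ = X ^ 4 * ((M.gcd c ^ 2 : ℕ) : ℝ) := by ring

/-- **The face bound.** On at most four indices with positive values, pairwise switching bounds
with parameter `X ≥ 1` and a bound `gcd_M c ≤ Y`, `Y ≥ 1`, on the common depth give
`∏_{M} c ≤ X¹⁶ · Y⁸` (each `c_p ≤ X⁴ G²`, at most four factors). -/
theorem prod_le_of_pairwise (M : Finset ℕ) (c : ℕ → ℕ) (X Y : ℝ) (hX : 1 ≤ X) (hY : 1 ≤ Y)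
    (hcard : M.card ≤ 4) (hpos : ∀ p ∈ M, 0 < c p)
    (hpair : ∀ p ∈ M, ∀ q ∈ M, p ≠ q →
      ((c p * c q : ℕ) : ℝ) ≤ X * ((Nat.gcd (c p) (c q) ^ 2 : ℕ) : ℝ))
    (hdepth : ((M.gcd c : ℕ) : ℝ) ≤ Y) :
    ((∏ p ∈ M, c p : ℕ) : ℝ) ≤ X ^ 16 * Y ^ 8 := by
  by_cases hM : M = ∅
  · subst hM
    simp only [Finset.prod_empty, Nat.cast_one]
    exact one_le_mul_of_one_le_of_one_le (one_le_pow₀ hX) (one_le_pow₀ hY)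
  have hne : M.Nonempty := Finset.nonempty_iff_ne_empty.mpr hM
  have hG0 : 0 < M.gcd c := Nat.pos_of_ne_zero (by
    rw [Ne, Finset.gcd_eq_zero_iff]; push Not
    obtain ⟨p, hp⟩ := hne
    exact ⟨p, hp, (hpos p hp).ne'⟩)
  have hG1 : (1 : ℝ) ≤ ((M.gcd c : ℕ) : ℝ) := by exact_mod_cast hG0
  have hX4 : (1 : ℝ) ≤ X ^ 4 := one_le_pow₀ hX
  have hsq : ((M.gcd c ^ 2 : ℕ) : ℝ) = ((M.gcd c : ℕ) : ℝ) ^ 2 := by push_cast; ring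
  have hG2 : (1 : ℝ) ≤ ((M.gcd c ^ 2 : ℕ) : ℝ) := by rw [hsq]; exact one_le_pow₀ hG1
  -- each value is at most `X⁴ G²`
  have hsingle : ∀ p ∈ M, ((c p : ℕ) : ℝ) ≤ X ^ 4 * ((M.gcd c ^ 2 : ℕ) : ℝ) := by
    intro p hp
    by_cases h2 : ∃ q ∈ M, q ≠ p
    · obtain ⟨q, hq, hqp⟩ := h2
      have hle : ((c p : ℕ) : ℝ) ≤ ((c p * c q : ℕ) : ℝ) := by
        exact_mod_cast Nat.le_mul_of_pos_right _ (hpos q hq)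
      exact hle.trans (pair_le_of_pairwise M c X hX hcard hpos hpair hp hq (Ne.symm hqp))
    · push Not at h2
      have hdvd : c p ∣ M.gcd c := Finset.dvd_gcd (fun b hb => by
        obtain rfl := h2 b hb
        exact dvd_rfl)
      have hle : ((c p : ℕ) : ℝ) ≤ ((M.gcd c : ℕ) : ℝ) := by
        exact_mod_cast Nat.le_of_dvd hG0 hdvd
      have hle2 : ((M.gcd c : ℕ) : ℝ) ≤ ((M.gcd c ^ 2 : ℕ) : ℝ) := by
        exact_mod_cast Nat.le_self_pow (by norm_num) _
      calc ((c p : ℕ) : ℝ) ≤ ((M.gcd c ^ 2 : ℕ) : ℝ) := hle.trans hle2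
        _ = 1 * ((M.gcd c ^ 2 : ℕ) : ℝ) := (one_mul _).symm
        _ ≤ X ^ 4 * ((M.gcd c ^ 2 : ℕ) : ℝ) := mul_le_mul_of_nonneg_right hX4 (by positivity)
  have hbase : (1 : ℝ) ≤ X ^ 4 * ((M.gcd c ^ 2 : ℕ) : ℝ) :=
    one_le_mul_of_one_le_of_one_le hX4 hG2
  calc ((∏ p ∈ M, c p : ℕ) : ℝ) = ∏ p ∈ M, ((c p : ℕ) : ℝ) := by push_cast; rfl
    _ ≤ ∏ _p ∈ M, (X ^ 4 * ((M.gcd c ^ 2 : ℕ) : ℝ)) :=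
        Finset.prod_le_prod (fun _ _ => by positivity) hsingle
    _ = (X ^ 4 * ((M.gcd c ^ 2 : ℕ) : ℝ)) ^ M.card := Finset.prod_const _
    _ ≤ (X ^ 4 * ((M.gcd c ^ 2 : ℕ) : ℝ)) ^ 4 := pow_le_pow_right₀ hbase hcard
    _ ≤ (X ^ 4 * Y ^ 2) ^ 4 := by
        apply pow_le_pow_left₀ (by positivity)
        apply mul_le_mul_of_nonneg_left _ (by positivity)
        rw [hsq]
        exact pow_le_pow_left₀ (by positivity) hdepth 2
    _ = X ^ 16 * Y ^ 8 := by ring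

/-! ## Part B — aggregation arithmetic (sorry-free) -/

/-- Distinct prime powers each dividing `n ≠ 0` divide it jointly. -/
theorem prod_primePow_dvd {T : Finset ℕ} (hT : ∀ ℓ ∈ T, ℓ.Prime) (k : ℕ → ℕ) {n : ℕ} (hn : n ≠ 0)
    (h : ∀ ℓ ∈ T, ℓ ^ k ℓ ∣ n) : ∏ ℓ ∈ T, ℓ ^ k ℓ ∣ n := by
  have hP0 : ∏ ℓ ∈ T, ℓ ^ k ℓ ≠ 0 :=
    Finset.prod_ne_zero_iff.mpr fun ℓ hℓ => pow_ne_zero _ (hT ℓ hℓ).ne_zero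
  rw [← Nat.factorization_le_iff_dvd hP0 hn,
    Nat.factorization_prod fun ℓ hℓ => pow_ne_zero _ (hT ℓ hℓ).ne_zero]
  intro q
  rw [Finsupp.finsetSum_apply,
    Finset.sum_congr rfl fun ℓ hℓ => by rw [(hT ℓ hℓ).factorization_pow]]
  simp only [Finsupp.single_apply]
  rw [Finset.sum_ite_eq']
  split_ifs with hq
  · exact ((hT q hq).pow_dvd_iff_le_factorization hn).mp (h q hq)
  · exact Nat.zero_le _

/-- Hasse in the form used here: `|a_v(W)| ≤ 2√v ≤ 2v` at a prime `v` (from the tree's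
`WeierstrassCurve.abs_LFunction_prime_pow_le`, Manin's elementary proof of Hasse's theorem). -/
theorem abs_LFunction_prime_le (W : WeierstrassCurve ℚ) [W.IsElliptic] {v : ℕ} (hv : v.Prime) :
    |(W.LFunction v : ℝ)| ≤ 2 * v := by
  have h := W.abs_LFunction_prime_pow_le hv 1
  simp only [pow_one] at h
  norm_num at h
  have h1 : (1 : ℝ) ≤ v := by exact_mod_cast hv.one_lt.le
  have hs : Real.sqrt v ≤ v := by
    calc Real.sqrt v ≤ Real.sqrt ((v : ℝ) ^ 2) := Real.sqrt_le_sqrt (by nlinarith)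
      _ = v := Real.sqrt_sq (by positivity)
  linarith

/-! ## Part C — the depth bound from stubs 2–4 (sorry-free aggregation)

`DepthBound`: for every `ε > 0` there is `C` with `d ≤ C N^ε` for every common divisor `d` of the
`c_p`, `p` multiplicative, of an `E` in the class (with at least one multiplicative prime). -/

/-- **Aggregation** (the card's step (iii), PROVED): fixed-level congruence + least distinguishing
prime + small-prime depth ⟹ the depth bound. For `d = ∏ ℓ^{m_ℓ}`: the `ℓ < ℓ₀` part is
`≤ ∏_{ℓ<ℓ₀} B(ℓ)`; for `ℓ ≥ ℓ₀` group the prime powers by partner `E₀ ∈ S` — all those with partner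
`E₀` divide the NON-ZERO integer `a_v(E) − a_v(E₀)` at the distinguishing prime `v = v(E, E₀)`,
whose size is `≤ 4v ≤ 4 C_{E₀} N^{ε'}` by Hasse; so `d ≤ B · ∏_{E₀ ∈ S} 4 C_{E₀} N^{ε'}`,
`ε' = ε/(#S + 1)`. -/
theorem depthBound_of
    (hcong : ∃ ℓ₀ : ℕ, ∃ S : Finset (WeierstrassCurve ℚ),
      (∀ W₀ ∈ S, W₀.IsElliptic ∧ (∀ p ∈ (W₀.conductorNorm ℤ).primeFactors, p = 2) ∧
        2 ^ 2 ∣ W₀.conductorNorm ℤ) ∧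
      ∀ (ℓ m : ℕ), ℓ.Prime → ℓ₀ ≤ ℓ → 1 ≤ m → ∀ (W : WeierstrassCurve ℚ) [W.IsElliptic],
        (∀ p : ℕ, p.Prime → p ≠ 2 → ¬ p ^ 2 ∣ W.conductorNorm ℤ) →
        ((W.conductorNorm ℤ).primeFactors.filter
          (fun p => p ≠ 2 ∧ ¬ p ^ 2 ∣ W.conductorNorm ℤ)).card ≤ 3 →
        ((W.conductorNorm ℤ).primeFactors.filter (fun p => ¬ p ^ 2 ∣ W.conductorNorm ℤ)).Nonempty →
        (∀ p ∈ (W.conductorNorm ℤ).primeFactors.filter (fun p => ¬ p ^ 2 ∣ W.conductorNorm ℤ),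
          0 < (W.minimalDiscriminantNorm ℤ).factorization p) →
        (∀ p ∈ (W.conductorNorm ℤ).primeFactors.filter (fun p => ¬ p ^ 2 ∣ W.conductorNorm ℤ),
          ℓ ^ m ∣ (W.minimalDiscriminantNorm ℤ).factorization p) →
        ∃ W₀ ∈ S, ∀ v : ℕ, v.Prime → ¬ v ∣ 2 * W.conductorNorm ℤ →
          ((ℓ ^ m : ℕ) : ℤ) ∣ W.LFunction v - W₀.LFunction v)
    (hldp : ∀ (W₀ : WeierstrassCurve ℚ) [W₀.IsElliptic],
      (∀ p ∈ (W₀.conductorNorm ℤ).primeFactors, p = 2) → 2 ^ 2 ∣ W₀.conductorNorm ℤ →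
      ∀ ε : ℝ, 0 < ε → ∃ C : ℝ, ∀ (W : WeierstrassCurve ℚ) [W.IsElliptic],
        (∀ p : ℕ, p.Prime → p ≠ 2 → ¬ p ^ 2 ∣ W.conductorNorm ℤ) →
        ((W.conductorNorm ℤ).primeFactors.filter
          (fun p => p ≠ 2 ∧ ¬ p ^ 2 ∣ W.conductorNorm ℤ)).card ≤ 3 →
        ((W.conductorNorm ℤ).primeFactors.filter (fun p => ¬ p ^ 2 ∣ W.conductorNorm ℤ)).Nonempty →
        ∃ v : ℕ, v.Prime ∧ ¬ v ∣ 2 * W.conductorNorm ℤ ∧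
          (v : ℝ) ≤ C * (W.conductorNorm ℤ : ℝ) ^ ε ∧ W.LFunction v ≠ W₀.LFunction v)
    (hsmall : ∀ ℓ : ℕ, ℓ.Prime → ∃ B : ℝ, ∀ (W : WeierstrassCurve ℚ) [W.IsElliptic],
      (∀ p : ℕ, p.Prime → p ≠ 2 → ¬ p ^ 2 ∣ W.conductorNorm ℤ) →
      ((W.conductorNorm ℤ).primeFactors.filter
        (fun p => p ≠ 2 ∧ ¬ p ^ 2 ∣ W.conductorNorm ℤ)).card ≤ 3 →
      ((W.conductorNorm ℤ).primeFactors.filter (fun p => ¬ p ^ 2 ∣ W.conductorNorm ℤ)).Nonempty →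
      (∀ p ∈ (W.conductorNorm ℤ).primeFactors.filter (fun p => ¬ p ^ 2 ∣ W.conductorNorm ℤ),
        0 < (W.minimalDiscriminantNorm ℤ).factorization p) →
      ∀ m : ℕ,
        (∀ p ∈ (W.conductorNorm ℤ).primeFactors.filter (fun p => ¬ p ^ 2 ∣ W.conductorNorm ℤ),
          ℓ ^ m ∣ (W.minimalDiscriminantNorm ℤ).factorization p) →
        ((ℓ ^ m : ℕ) : ℝ) ≤ B) :
    ∀ ε : ℝ, 0 < ε → ∃ C : ℝ, ∀ (W : WeierstrassCurve ℚ) [W.IsElliptic],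
      (∀ p : ℕ, p.Prime → p ≠ 2 → ¬ p ^ 2 ∣ W.conductorNorm ℤ) →
      ((W.conductorNorm ℤ).primeFactors.filter
        (fun p => p ≠ 2 ∧ ¬ p ^ 2 ∣ W.conductorNorm ℤ)).card ≤ 3 →
      ((W.conductorNorm ℤ).primeFactors.filter (fun p => ¬ p ^ 2 ∣ W.conductorNorm ℤ)).Nonempty →
      (∀ p ∈ (W.conductorNorm ℤ).primeFactors.filter (fun p => ¬ p ^ 2 ∣ W.conductorNorm ℤ),
        0 < (W.minimalDiscriminantNorm ℤ).factorization p) →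
      ∀ d : ℕ,
        (∀ p ∈ (W.conductorNorm ℤ).primeFactors.filter (fun p => ¬ p ^ 2 ∣ W.conductorNorm ℤ),
          d ∣ (W.minimalDiscriminantNorm ℤ).factorization p) →
        (d : ℝ) ≤ C * (W.conductorNorm ℤ : ℝ) ^ ε := by
  classical
  intro ε hε
  obtain ⟨ℓ₀, S, hS, hcong⟩ := hcong
  -- exponent budget
  set s : ℕ := S.card with hs
  set ε' : ℝ := ε / ((s : ℝ) + 1) with hε'
  have hε'pos : 0 < ε' := by positivity
  have hε's : ε' * (s : ℝ) ≤ ε := by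
    rw [hε', div_mul_eq_mul_div, div_le_iff₀ (by positivity : (0 : ℝ) < (s : ℝ) + 1)]
    nlinarith [hε.le, (Nat.cast_nonneg s : (0 : ℝ) ≤ s)]
  -- one constant per partner, from the least-distinguishing-prime statement at `ε'`
  have key3 : ∀ W₀ ∈ S, ∃ C : ℝ, 1 ≤ C ∧ ∀ (W : WeierstrassCurve ℚ) [W.IsElliptic],
      (∀ p : ℕ, p.Prime → p ≠ 2 → ¬ p ^ 2 ∣ W.conductorNorm ℤ) →
      ((W.conductorNorm ℤ).primeFactors.filter
        (fun p => p ≠ 2 ∧ ¬ p ^ 2 ∣ W.conductorNorm ℤ)).card ≤ 3 →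
      ((W.conductorNorm ℤ).primeFactors.filter (fun p => ¬ p ^ 2 ∣ W.conductorNorm ℤ)).Nonempty →
      ∃ v : ℕ, v.Prime ∧ ¬ v ∣ 2 * W.conductorNorm ℤ ∧
        (v : ℝ) ≤ C * (W.conductorNorm ℤ : ℝ) ^ ε' ∧ W.LFunction v ≠ W₀.LFunction v := by
    intro W₀ hW₀
    haveI := (hS W₀ hW₀).1
    obtain ⟨C, hC⟩ := hldp W₀ (hS W₀ hW₀).2.1 (hS W₀ hW₀).2.2 ε' hε'pos
    refine ⟨max C 1, le_max_right _ _, fun W _ hsf hcard hne => ?_⟩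
    obtain ⟨v, hv, hvN, hvle, hne'⟩ := hC W hsf hcard hne
    refine ⟨v, hv, hvN, hvle.trans ?_, hne'⟩
    exact mul_le_mul_of_nonneg_right (le_max_left _ _) (by positivity)
  choose! Cf hCf1 hCf using key3
  -- one constant per prime below `ℓ₀`, from the small-prime statement
  have key4 : ∀ ℓ ∈ (Finset.range ℓ₀).filter Nat.Prime, ∃ B : ℝ, 1 ≤ B ∧
      ∀ (W : WeierstrassCurve ℚ) [W.IsElliptic],
      (∀ p : ℕ, p.Prime → p ≠ 2 → ¬ p ^ 2 ∣ W.conductorNorm ℤ) →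
      ((W.conductorNorm ℤ).primeFactors.filter
        (fun p => p ≠ 2 ∧ ¬ p ^ 2 ∣ W.conductorNorm ℤ)).card ≤ 3 →
      ((W.conductorNorm ℤ).primeFactors.filter (fun p => ¬ p ^ 2 ∣ W.conductorNorm ℤ)).Nonempty →
      (∀ p ∈ (W.conductorNorm ℤ).primeFactors.filter (fun p => ¬ p ^ 2 ∣ W.conductorNorm ℤ),
        0 < (W.minimalDiscriminantNorm ℤ).factorization p) →
      ∀ m : ℕ,
        (∀ p ∈ (W.conductorNorm ℤ).primeFactors.filter (fun p => ¬ p ^ 2 ∣ W.conductorNorm ℤ),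
          ℓ ^ m ∣ (W.minimalDiscriminantNorm ℤ).factorization p) →
        ((ℓ ^ m : ℕ) : ℝ) ≤ B := by
    intro ℓ hℓ
    obtain ⟨B, hB⟩ := hsmall ℓ (Finset.mem_filter.mp hℓ).2
    refine ⟨max B 1, le_max_right _ _, fun W _ hsf hcard hne hpos m hm => ?_⟩
    exact (hB W hsf hcard hne hpos m hm).trans (le_max_left _ _)
  choose! Bf hBf1 hBf using key4
  set Bsm : ℝ := ∏ ℓ ∈ (Finset.range ℓ₀).filter Nat.Prime, Bf ℓ with hBsm
  have hBsm1 : 1 ≤ Bsm := by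
    rw [hBsm]
    calc (1 : ℝ) = ∏ _ℓ ∈ (Finset.range ℓ₀).filter Nat.Prime, (1 : ℝ) :=
          Finset.prod_const_one.symm
      _ ≤ _ := Finset.prod_le_prod (fun _ _ => zero_le_one) (fun ℓ hℓ => hBf1 ℓ hℓ)
  set CS : ℝ := ∏ W₀ ∈ S, (4 * Cf W₀) with hCS
  have hCS0 : 0 ≤ CS := by
    rw [hCS]
    exact Finset.prod_nonneg fun W₀ hW₀ => by linarith [hCf1 W₀ hW₀]
  refine ⟨Bsm * CS, ?_⟩
  intro W _ hsf hcard hne hpos d hd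
  obtain ⟨p₀, hp₀⟩ := id hne
  have hNpos : 0 < W.conductorNorm ℤ := WeierstrassCurve.conductorNorm_pos_holds W
  have hN1 : (1 : ℝ) ≤ (W.conductorNorm ℤ : ℝ) := by exact_mod_cast hNpos
  have hN0 : (0 : ℝ) < (W.conductorNorm ℤ : ℝ) := by linarith
  -- `d ≠ 0`
  have hd0 : d ≠ 0 := by
    rintro rfl
    have h0 := hd p₀ hp₀
    rw [zero_dvd_iff] at h0
    exact (hpos p₀ hp₀).ne' h0
  -- factor `d` and split its primes at `ℓ₀`
  have hdprod : ∏ ℓ ∈ d.primeFactors, ℓ ^ d.factorization ℓ = d := by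
    have h := Nat.prod_factorization_pow_eq_self hd0
    rwa [Finsupp.prod, Nat.support_factorization] at h
  set small := d.primeFactors.filter (fun ℓ => ℓ < ℓ₀) with hsmalldef
  set large := d.primeFactors.filter (fun ℓ => ¬ ℓ < ℓ₀) with hlargedef
  have hsplit : (∏ ℓ ∈ small, ℓ ^ d.factorization ℓ) * (∏ ℓ ∈ large, ℓ ^ d.factorization ℓ) = d := by
    rw [hsmalldef, hlargedef, Finset.prod_filter_mul_prod_filter_not, hdprod]
  have hpow_dvd : ∀ ℓ : ℕ, ∀ p ∈ (W.conductorNorm ℤ).primeFactors.filter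
      (fun p => ¬ p ^ 2 ∣ W.conductorNorm ℤ),
      ℓ ^ d.factorization ℓ ∣ (W.minimalDiscriminantNorm ℤ).factorization p :=
    fun ℓ p hp => (Nat.ordProj_dvd d ℓ).trans (hd p hp)
  -- the small part
  have hsmall_le : ((∏ ℓ ∈ small, ℓ ^ d.factorization ℓ : ℕ) : ℝ) ≤ Bsm := by
    rw [Nat.cast_prod]
    have h1 : ∀ ℓ ∈ small, ((ℓ ^ d.factorization ℓ : ℕ) : ℝ) ≤ Bf ℓ := by
      intro ℓ hℓ
      have hℓ' := Finset.mem_filter.mp hℓ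
      have hmem : ℓ ∈ (Finset.range ℓ₀).filter Nat.Prime :=
        Finset.mem_filter.mpr ⟨Finset.mem_range.mpr hℓ'.2, Nat.prime_of_mem_primeFactors hℓ'.1⟩
      exact hBf ℓ hmem W hsf hcard hne hpos (d.factorization ℓ) (hpow_dvd ℓ)
    have hsub : small ⊆ (Finset.range ℓ₀).filter Nat.Prime := fun ℓ hℓ => by
      have hℓ' := Finset.mem_filter.mp hℓ
      exact Finset.mem_filter.mpr ⟨Finset.mem_range.mpr hℓ'.2, Nat.prime_of_mem_primeFactors hℓ'.1⟩
    have hrest : (1 : ℝ) ≤ ∏ ℓ ∈ ((Finset.range ℓ₀).filter Nat.Prime) \ small, Bf ℓ := by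
      calc (1 : ℝ) = ∏ _ℓ ∈ ((Finset.range ℓ₀).filter Nat.Prime) \ small, (1 : ℝ) :=
            Finset.prod_const_one.symm
        _ ≤ _ := Finset.prod_le_prod (fun _ _ => zero_le_one)
            (fun ℓ hℓ => hBf1 ℓ (Finset.mem_sdiff.mp hℓ).1)
    calc ∏ ℓ ∈ small, ((ℓ ^ d.factorization ℓ : ℕ) : ℝ) ≤ ∏ ℓ ∈ small, Bf ℓ :=
          Finset.prod_le_prod (fun _ _ => by positivity) h1
      _ ≤ (∏ ℓ ∈ ((Finset.range ℓ₀).filter Nat.Prime) \ small, Bf ℓ) * ∏ ℓ ∈ small, Bf ℓ :=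
          le_mul_of_one_le_left (Finset.prod_nonneg fun ℓ hℓ => by
            linarith [hBf1 ℓ (hsub hℓ)]) hrest
      _ = Bsm := by rw [hBsm, Finset.prod_sdiff hsub]
  -- the large part: partners and distinguishing primes
  have hlarge_mem : ∀ ℓ ∈ large, ℓ.Prime ∧ ℓ₀ ≤ ℓ ∧ 1 ≤ d.factorization ℓ := by
    intro ℓ hℓ
    have hℓ' := Finset.mem_filter.mp hℓ
    have hℓp : ℓ.Prime := Nat.prime_of_mem_primeFactors hℓ'.1
    exact ⟨hℓp, not_lt.mp hℓ'.2,
      hℓp.factorization_pos_of_dvd hd0 (Nat.dvd_of_mem_primeFactors hℓ'.1)⟩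
  have key2 : ∀ ℓ ∈ large, ∃ W₀ ∈ S, ∀ v : ℕ, v.Prime → ¬ v ∣ 2 * W.conductorNorm ℤ →
      ((ℓ ^ d.factorization ℓ : ℕ) : ℤ) ∣ W.LFunction v - W₀.LFunction v := by
    intro ℓ hℓ
    obtain ⟨hℓp, hℓ₀, hm⟩ := hlarge_mem ℓ hℓ
    exact hcong ℓ (d.factorization ℓ) hℓp hℓ₀ hm W hsf hcard hne hpos (hpow_dvd ℓ)
  haveI : Nonempty (WeierstrassCurve ℚ) := ⟨W⟩
  choose! π hπS hπ using key2
  have key3W : ∀ W₀ ∈ S, ∃ v : ℕ, v.Prime ∧ ¬ v ∣ 2 * W.conductorNorm ℤ ∧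
      (v : ℝ) ≤ Cf W₀ * (W.conductorNorm ℤ : ℝ) ^ ε' ∧ W.LFunction v ≠ W₀.LFunction v :=
    fun W₀ hW₀ => hCf W₀ hW₀ W hsf hcard hne
  choose! vf hvp hvN hvle hvne using key3W
  -- the non-zero integer `a_v(W) − a_v(W₀)` and its size
  have hD : ∀ W₀ ∈ S, (W.LFunction (vf W₀) - W₀.LFunction (vf W₀)).natAbs ≠ 0 ∧
      (((W.LFunction (vf W₀) - W₀.LFunction (vf W₀)).natAbs : ℕ) : ℝ) ≤
        4 * Cf W₀ * (W.conductorNorm ℤ : ℝ) ^ ε' := by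
    intro W₀ hW₀
    haveI := (hS W₀ hW₀).1
    refine ⟨Int.natAbs_ne_zero.mpr (sub_ne_zero.mpr (hvne W₀ hW₀)), ?_⟩
    rw [Nat.cast_natAbs, Int.cast_abs, Int.cast_sub]
    have h1 := abs_LFunction_prime_le W (hvp W₀ hW₀)
    have h2 := abs_LFunction_prime_le W₀ (hvp W₀ hW₀)
    have h3 := hvle W₀ hW₀
    calc |((W.LFunction (vf W₀) : ℤ) : ℝ) - ((W₀.LFunction (vf W₀) : ℤ) : ℝ)|
        ≤ |((W.LFunction (vf W₀) : ℤ) : ℝ)| + |((W₀.LFunction (vf W₀) : ℤ) : ℝ)| := abs_sub _ _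
      _ ≤ 2 * (vf W₀ : ℝ) + 2 * (vf W₀ : ℝ) := add_le_add h1 h2
      _ = 4 * (vf W₀ : ℝ) := by ring
      _ ≤ 4 * (Cf W₀ * (W.conductorNorm ℤ : ℝ) ^ ε') := by linarith
      _ = 4 * Cf W₀ * (W.conductorNorm ℤ : ℝ) ^ ε' := by ring
  -- group the large prime powers by partner
  have hlarge_eq : ∏ ℓ ∈ large, ℓ ^ d.factorization ℓ =
      ∏ W₀ ∈ S, ∏ ℓ ∈ large.filter (fun ℓ => π ℓ = W₀), ℓ ^ d.factorization ℓ :=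
    (Finset.prod_fiberwise_of_maps_to (fun ℓ hℓ => hπS ℓ hℓ) _).symm
  have hinner : ∀ W₀ ∈ S,
      ((∏ ℓ ∈ large.filter (fun ℓ => π ℓ = W₀), ℓ ^ d.factorization ℓ : ℕ) : ℝ) ≤
        4 * Cf W₀ * (W.conductorNorm ℤ : ℝ) ^ ε' := by
    intro W₀ hW₀
    obtain ⟨hD0, hDle⟩ := hD W₀ hW₀
    refine le_trans ?_ hDle
    have hdvd : ∏ ℓ ∈ large.filter (fun ℓ => π ℓ = W₀), ℓ ^ d.factorization ℓ ∣
        (W.LFunction (vf W₀) - W₀.LFunction (vf W₀)).natAbs := by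
      refine prod_primePow_dvd (fun ℓ hℓ => (hlarge_mem ℓ (Finset.mem_filter.mp hℓ).1).1)
        (fun ℓ => d.factorization ℓ) hD0 (fun ℓ hℓ => ?_)
      have hℓ' := Finset.mem_filter.mp hℓ
      have h := hπ ℓ hℓ'.1 (vf W₀) (hvp W₀ hW₀) (hvN W₀ hW₀)
      rw [hℓ'.2] at h
      exact Int.natCast_dvd.mp h
    exact_mod_cast Nat.le_of_dvd (Nat.pos_of_ne_zero hD0) hdvd
  have hlarge_le : ((∏ ℓ ∈ large, ℓ ^ d.factorization ℓ : ℕ) : ℝ) ≤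
      CS * (W.conductorNorm ℤ : ℝ) ^ (ε' * (s : ℝ)) := by
    rw [hlarge_eq, Nat.cast_prod]
    calc ∏ W₀ ∈ S, ((∏ ℓ ∈ large.filter (fun ℓ => π ℓ = W₀), ℓ ^ d.factorization ℓ : ℕ) : ℝ)
        ≤ ∏ W₀ ∈ S, (4 * Cf W₀ * (W.conductorNorm ℤ : ℝ) ^ ε') :=
          Finset.prod_le_prod (fun _ _ => by positivity) hinner
      _ = CS * ((W.conductorNorm ℤ : ℝ) ^ ε') ^ s := by
          rw [Finset.prod_mul_distrib, Finset.prod_const, hCS]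
      _ = CS * (W.conductorNorm ℤ : ℝ) ^ (ε' * (s : ℝ)) := by
          rw [← Real.rpow_natCast, ← Real.rpow_mul hN0.le]
  -- combine
  have hd_eq : (d : ℝ) = ((∏ ℓ ∈ small, ℓ ^ d.factorization ℓ : ℕ) : ℝ) *
      ((∏ ℓ ∈ large, ℓ ^ d.factorization ℓ : ℕ) : ℝ) := by
    rw [← Nat.cast_mul, hsplit]
  rw [hd_eq]
  calc ((∏ ℓ ∈ small, ℓ ^ d.factorization ℓ : ℕ) : ℝ) *
        ((∏ ℓ ∈ large, ℓ ^ d.factorization ℓ : ℕ) : ℝ)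
      ≤ Bsm * (CS * (W.conductorNorm ℤ : ℝ) ^ (ε' * (s : ℝ))) :=
        mul_le_mul hsmall_le hlarge_le (by positivity) (by linarith)
    _ = (Bsm * CS) * (W.conductorNorm ℤ : ℝ) ^ (ε' * (s : ℝ)) := by ring
    _ ≤ (Bsm * CS) * (W.conductorNorm ℤ : ℝ) ^ ε := by
        apply mul_le_mul_of_nonneg_left _ (by positivity)
        exact Real.rpow_le_rpow_of_exponent_le hN1 hε's

/-! ## Part D — the crux from the pair bound and the depth bound (sorry-free) -/

/-- **Faces** (PROVED): the pair switching bound and the depth bound imply the crux — stated here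
with the crux UNFOLDED (verbatim the body of `RibetTakahashiSplit.FewPrimeValuationProduct`), so that
only `FewPrimeValuationProduct_of` concludes the route decl by name. With
`δ = ε/24`, `X = K_δ N^δ ≥ 1`, `Y = C_δ N^δ ≥ 1`: if some `c_p = 0` the product vanishes; otherwise
`#Mult ≤ 4` (at most three odd multiplicative primes and possibly `2`), the depth `G = gcd c_p`
divides every `c_p` so `G ≤ Y`, and `prod_le_of_pairwise` gives `T ≤ X¹⁶ Y⁸ = K¹⁶ C⁸ N^ε`. -/
theorem fewPrime_of_pair_depth
    (hpair : ∀ ε : ℝ, 0 < ε → ∃ K : ℝ, ∀ (W : WeierstrassCurve ℚ) [W.IsElliptic],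
      (∀ p : ℕ, p.Prime → p ≠ 2 → ¬ p ^ 2 ∣ W.conductorNorm ℤ) →
      ((W.conductorNorm ℤ).primeFactors.filter
        (fun p => p ≠ 2 ∧ ¬ p ^ 2 ∣ W.conductorNorm ℤ)).card ≤ 3 →
      (∀ p ∈ (W.conductorNorm ℤ).primeFactors.filter (fun p => ¬ p ^ 2 ∣ W.conductorNorm ℤ),
        0 < (W.minimalDiscriminantNorm ℤ).factorization p) →
      ∀ p ∈ (W.conductorNorm ℤ).primeFactors.filter (fun p => ¬ p ^ 2 ∣ W.conductorNorm ℤ),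
      ∀ q ∈ (W.conductorNorm ℤ).primeFactors.filter (fun p => ¬ p ^ 2 ∣ W.conductorNorm ℤ),
        p ≠ q →
        (((W.minimalDiscriminantNorm ℤ).factorization p *
            (W.minimalDiscriminantNorm ℤ).factorization q : ℕ) : ℝ) ≤
          K * (W.conductorNorm ℤ : ℝ) ^ ε *
            ((Nat.gcd ((W.minimalDiscriminantNorm ℤ).factorization p)
                ((W.minimalDiscriminantNorm ℤ).factorization q) ^ 2 : ℕ) : ℝ))
    (hdepth : ∀ ε : ℝ, 0 < ε → ∃ C : ℝ, ∀ (W : WeierstrassCurve ℚ) [W.IsElliptic],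
      (∀ p : ℕ, p.Prime → p ≠ 2 → ¬ p ^ 2 ∣ W.conductorNorm ℤ) →
      ((W.conductorNorm ℤ).primeFactors.filter
        (fun p => p ≠ 2 ∧ ¬ p ^ 2 ∣ W.conductorNorm ℤ)).card ≤ 3 →
      ((W.conductorNorm ℤ).primeFactors.filter (fun p => ¬ p ^ 2 ∣ W.conductorNorm ℤ)).Nonempty →
      (∀ p ∈ (W.conductorNorm ℤ).primeFactors.filter (fun p => ¬ p ^ 2 ∣ W.conductorNorm ℤ),
        0 < (W.minimalDiscriminantNorm ℤ).factorization p) →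
      ∀ d : ℕ,
        (∀ p ∈ (W.conductorNorm ℤ).primeFactors.filter (fun p => ¬ p ^ 2 ∣ W.conductorNorm ℤ),
          d ∣ (W.minimalDiscriminantNorm ℤ).factorization p) →
        (d : ℝ) ≤ C * (W.conductorNorm ℤ : ℝ) ^ ε) :
    ∀ ε : ℝ, 0 < ε → ∃ C : ℝ, ∀ (W : WeierstrassCurve ℚ) [W.IsElliptic],
      (∀ p : ℕ, p.Prime → p ≠ 2 → ¬ p ^ 2 ∣ W.conductorNorm ℤ) →
      ((W.conductorNorm ℤ).primeFactors.filter
        (fun p => p ≠ 2 ∧ ¬ p ^ 2 ∣ W.conductorNorm ℤ)).card ≤ 3 →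
      ((∏ p ∈ (W.conductorNorm ℤ).primeFactors with ¬ p ^ 2 ∣ W.conductorNorm ℤ,
        (W.minimalDiscriminantNorm ℤ).factorization p : ℕ) : ℝ) ≤ C * (W.conductorNorm ℤ : ℝ) ^ ε := by
  intro ε hε
  set δ : ℝ := ε / 24 with hδ
  have hδpos : 0 < δ := by positivity
  obtain ⟨K₀, hK₀⟩ := hpair δ hδpos
  obtain ⟨C₀, hC₀⟩ := hdepth δ hδpos
  set K : ℝ := max K₀ 1 with hK
  set Cd : ℝ := max C₀ 1 with hCd
  have hK1 : 1 ≤ K := le_max_right _ _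
  have hCd1 : 1 ≤ Cd := le_max_right _ _
  refine ⟨K ^ 16 * Cd ^ 8, ?_⟩
  intro W _ hsf hcard
  set N : ℕ := W.conductorNorm ℤ with hN
  have hNpos : 0 < N := WeierstrassCurve.conductorNorm_pos_holds W
  have hN1 : (1 : ℝ) ≤ (N : ℝ) := by exact_mod_cast hNpos
  have hN0 : (0 : ℝ) < (N : ℝ) := by linarith
  set M : Finset ℕ := N.primeFactors.filter (fun p => ¬ p ^ 2 ∣ N) with hM
  set c : ℕ → ℕ := fun p => (W.minimalDiscriminantNorm ℤ).factorization p with hc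
  change ((∏ p ∈ M, c p : ℕ) : ℝ) ≤ K ^ 16 * Cd ^ 8 * (N : ℝ) ^ ε
  have hMcard : M.card ≤ 4 := by
    have hsub : M ⊆ insert 2 (N.primeFactors.filter (fun p => p ≠ 2 ∧ ¬ p ^ 2 ∣ N)) := by
      intro p hp
      rw [Finset.mem_insert, Finset.mem_filter]
      rw [hM, Finset.mem_filter] at hp
      by_cases h2 : p = 2
      · exact Or.inl h2
      · exact Or.inr ⟨hp.1, h2, hp.2⟩
    calc M.card ≤ _ := Finset.card_le_card hsub
      _ ≤ (N.primeFactors.filter (fun p => p ≠ 2 ∧ ¬ p ^ 2 ∣ N)).card + 1 :=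
          Finset.card_insert_le _ _
      _ ≤ 4 := by omega
  have hX1 : 1 ≤ K * (N : ℝ) ^ δ :=
    one_le_mul_of_one_le_of_one_le hK1 (Real.one_le_rpow hN1 hδpos.le)
  have hY1 : 1 ≤ Cd * (N : ℝ) ^ δ :=
    one_le_mul_of_one_le_of_one_le hCd1 (Real.one_le_rpow hN1 hδpos.le)
  have hfinal : (K * (N : ℝ) ^ δ) ^ 16 * (Cd * (N : ℝ) ^ δ) ^ 8 = K ^ 16 * Cd ^ 8 * (N : ℝ) ^ ε := by
    have hexp : ((N : ℝ) ^ δ) ^ (16 : ℕ) * ((N : ℝ) ^ δ) ^ (8 : ℕ) = (N : ℝ) ^ ε := by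
      rw [← Real.rpow_natCast ((N : ℝ) ^ δ) 16, ← Real.rpow_natCast ((N : ℝ) ^ δ) 8,
        ← Real.rpow_mul hN0.le, ← Real.rpow_mul hN0.le, ← Real.rpow_add hN0]
      congr 1
      rw [hδ]; push_cast; ring
    calc (K * (N : ℝ) ^ δ) ^ 16 * (Cd * (N : ℝ) ^ δ) ^ 8
        = K ^ 16 * Cd ^ 8 * (((N : ℝ) ^ δ) ^ (16 : ℕ) * ((N : ℝ) ^ δ) ^ (8 : ℕ)) := by ring
      _ = K ^ 16 * Cd ^ 8 * (N : ℝ) ^ ε := by rw [hexp]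
  by_cases hzero : ∃ p ∈ M, c p = 0
  · obtain ⟨p, hp, hp0⟩ := hzero
    rw [Finset.prod_eq_zero hp hp0, Nat.cast_zero]
    positivity
  push Not at hzero
  have hpos : ∀ p ∈ M, 0 < c p := fun p hp => Nat.pos_of_ne_zero (hzero p hp)
  have hG : ((M.gcd c : ℕ) : ℝ) ≤ Cd * (N : ℝ) ^ δ := by
    by_cases hMe : M = ∅
    · rw [hMe, Finset.gcd_empty, Nat.cast_zero]
      positivity
    · have hne : M.Nonempty := Finset.nonempty_iff_ne_empty.mpr hMe
      have h := hC₀ W hsf hcard hne hpos (M.gcd c) (fun p hp => Finset.gcd_dvd hp)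
      exact h.trans (mul_le_mul_of_nonneg_right (le_max_left _ _) (by positivity))
  have hpair' : ∀ p ∈ M, ∀ q ∈ M, p ≠ q →
      ((c p * c q : ℕ) : ℝ) ≤ (K * (N : ℝ) ^ δ) * ((Nat.gcd (c p) (c q) ^ 2 : ℕ) : ℝ) := by
    intro p hp q hq hpq
    have h := hK₀ W hsf hcard hpos p hp q hq hpq
    calc ((c p * c q : ℕ) : ℝ) ≤ K₀ * (N : ℝ) ^ δ * ((Nat.gcd (c p) (c q) ^ 2 : ℕ) : ℝ) := h
      _ ≤ K * (N : ℝ) ^ δ * ((Nat.gcd (c p) (c q) ^ 2 : ℕ) : ℝ) := by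
        apply mul_le_mul_of_nonneg_right _ (by positivity)
        exact mul_le_mul_of_nonneg_right (le_max_left _ _) (by positivity)
  have key := prod_le_of_pairwise M c (K * (N : ℝ) ^ δ) (Cd * (N : ℝ) ^ δ) hX1 hY1 hMcard hpos hpair' hG
  calc ((∏ p ∈ M, c p : ℕ) : ℝ) ≤ (K * (N : ℝ) ^ δ) ^ 16 * (Cd * (N : ℝ) ^ δ) ^ 8 := key
    _ = K ^ 16 * Cd ^ 8 * (N : ℝ) ^ ε := hfinal

/-! ## Certificates (sorry-free, not stubs): the card's hinge, and the two halves are implied by the crux -/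

/-- **Hasse pinning** (the card's `First lemma`, elementary): two integers in the Hasse interval
`a², b² ≤ 4v` that are congruent modulo `M` with `M² > 16 v` are EQUAL. (The aggregation above uses
the cruder form "`M ∣ a − b ≠ 0 ⟹ M ≤ |a − b| ≤ 4v`".) -/
theorem hassePinning (M v : ℕ) (a b : ℤ) (ha : a ^ 2 ≤ 4 * v) (hb : b ^ 2 ≤ 4 * v)
    (hM : (M : ℤ) ∣ a - b) (hv : 16 * (v : ℤ) < (M : ℤ) ^ 2) : a = b := by
  by_contra hne
  have hne' : a - b ≠ 0 := sub_ne_zero.mpr hne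
  have hle : (M : ℤ) ≤ |a - b| := Int.le_of_dvd (abs_pos.mpr hne') ((dvd_abs _ _).mpr hM)
  have hM0 : (0 : ℤ) ≤ M := by positivity
  have h1 : (M : ℤ) ^ 2 ≤ |a - b| ^ 2 := pow_le_pow_left₀ hM0 hle 2
  rw [sq_abs] at h1
  nlinarith [sq_nonneg (a + b)]

/-- Certificate: the crux implies the pair switching bound (stub 1) — so stub 1 is a genuinely
weaker truth claim (nothing false is chased), and with `depthBound_of_fewPrime` the line is an
EQUIVALENT split `crux ⟺ stub 1 ∧ DepthBound` on the class. -/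
theorem pairSwitching_of_fewPrime
    (h : Summit.ABC.ABC.Theses.RibetTakahashiSplit.FewPrimeValuationProduct) :
    ∀ ε : ℝ, 0 < ε → ∃ K : ℝ, ∀ (W : WeierstrassCurve ℚ) [W.IsElliptic],
      (∀ p : ℕ, p.Prime → p ≠ 2 → ¬ p ^ 2 ∣ W.conductorNorm ℤ) →
      ((W.conductorNorm ℤ).primeFactors.filter
        (fun p => p ≠ 2 ∧ ¬ p ^ 2 ∣ W.conductorNorm ℤ)).card ≤ 3 →
      (∀ p ∈ (W.conductorNorm ℤ).primeFactors.filter (fun p => ¬ p ^ 2 ∣ W.conductorNorm ℤ),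
        0 < (W.minimalDiscriminantNorm ℤ).factorization p) →
      ∀ p ∈ (W.conductorNorm ℤ).primeFactors.filter (fun p => ¬ p ^ 2 ∣ W.conductorNorm ℤ),
      ∀ q ∈ (W.conductorNorm ℤ).primeFactors.filter (fun p => ¬ p ^ 2 ∣ W.conductorNorm ℤ),
        p ≠ q →
        (((W.minimalDiscriminantNorm ℤ).factorization p *
            (W.minimalDiscriminantNorm ℤ).factorization q : ℕ) : ℝ) ≤
          K * (W.conductorNorm ℤ : ℝ) ^ ε *
            ((Nat.gcd ((W.minimalDiscriminantNorm ℤ).factorization p)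
                ((W.minimalDiscriminantNorm ℤ).factorization q) ^ 2 : ℕ) : ℝ) := by
  classical
  intro ε hε
  obtain ⟨C, hC⟩ := h ε hε
  refine ⟨max C 0, ?_⟩
  intro W _ hsf hcard hpos p hp q hq hpq
  set M : Finset ℕ := (W.conductorNorm ℤ).primeFactors.filter (fun p => ¬ p ^ 2 ∣ W.conductorNorm ℤ)
    with hM
  set c : ℕ → ℕ := fun p => (W.minimalDiscriminantNorm ℤ).factorization p with hc
  have hT := hC W hsf hcard
  change ((∏ r ∈ M, c r : ℕ) : ℝ) ≤ C * (W.conductorNorm ℤ : ℝ) ^ ε at hT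
  have hTpos : 0 < ∏ r ∈ M, c r := Finset.prod_pos fun r hr => hpos r hr
  have hdvd : c p * c q ∣ ∏ r ∈ M, c r := by
    have hsub : ({p, q} : Finset ℕ) ⊆ M := by
      intro x hx
      rw [Finset.mem_insert, Finset.mem_singleton] at hx
      rcases hx with rfl | rfl
      · exact hp
      · exact hq
    have h2 : ∏ r ∈ ({p, q} : Finset ℕ), c r = c p * c q := Finset.prod_pair hpq
    rw [← h2]
    exact Finset.prod_dvd_prod_of_subset _ _ _ hsub
  have hle : ((c p * c q : ℕ) : ℝ) ≤ ((∏ r ∈ M, c r : ℕ) : ℝ) := by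
    exact_mod_cast Nat.le_of_dvd hTpos hdvd
  have hg1 : (1 : ℝ) ≤ ((Nat.gcd (c p) (c q) ^ 2 : ℕ) : ℝ) := by
    have hg : 0 < Nat.gcd (c p) (c q) := Nat.gcd_pos_of_pos_left _ (hpos p hp)
    exact_mod_cast Nat.one_le_pow _ _ hg
  have hN0 : (0 : ℝ) ≤ (W.conductorNorm ℤ : ℝ) ^ ε := by positivity
  calc ((c p * c q : ℕ) : ℝ) ≤ ((∏ r ∈ M, c r : ℕ) : ℝ) := hle
    _ ≤ C * (W.conductorNorm ℤ : ℝ) ^ ε := hT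
    _ ≤ max C 0 * (W.conductorNorm ℤ : ℝ) ^ ε := mul_le_mul_of_nonneg_right (le_max_left _ _) hN0
    _ = max C 0 * (W.conductorNorm ℤ : ℝ) ^ ε * 1 := (mul_one _).symm
    _ ≤ max C 0 * (W.conductorNorm ℤ : ℝ) ^ ε * ((Nat.gcd (c p) (c q) ^ 2 : ℕ) : ℝ) :=
        mul_le_mul_of_nonneg_left hg1 (by positivity)

/-- Certificate: the crux implies the depth bound (the conclusion of `depthBound_of`). -/
theorem depthBound_of_fewPrime
    (h : Summit.ABC.ABC.Theses.RibetTakahashiSplit.FewPrimeValuationProduct) :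
    ∀ ε : ℝ, 0 < ε → ∃ C : ℝ, ∀ (W : WeierstrassCurve ℚ) [W.IsElliptic],
      (∀ p : ℕ, p.Prime → p ≠ 2 → ¬ p ^ 2 ∣ W.conductorNorm ℤ) →
      ((W.conductorNorm ℤ).primeFactors.filter
        (fun p => p ≠ 2 ∧ ¬ p ^ 2 ∣ W.conductorNorm ℤ)).card ≤ 3 →
      ((W.conductorNorm ℤ).primeFactors.filter (fun p => ¬ p ^ 2 ∣ W.conductorNorm ℤ)).Nonempty →
      (∀ p ∈ (W.conductorNorm ℤ).primeFactors.filter (fun p => ¬ p ^ 2 ∣ W.conductorNorm ℤ),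
        0 < (W.minimalDiscriminantNorm ℤ).factorization p) →
      ∀ d : ℕ,
        (∀ p ∈ (W.conductorNorm ℤ).primeFactors.filter (fun p => ¬ p ^ 2 ∣ W.conductorNorm ℤ),
          d ∣ (W.minimalDiscriminantNorm ℤ).factorization p) →
        (d : ℝ) ≤ C * (W.conductorNorm ℤ : ℝ) ^ ε := by
  classical
  intro ε hε
  obtain ⟨C, hC⟩ := h ε hε
  refine ⟨C, ?_⟩
  intro W _ hsf hcard hne hpos d hd
  set M : Finset ℕ := (W.conductorNorm ℤ).primeFactors.filter (fun p => ¬ p ^ 2 ∣ W.conductorNorm ℤ)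
    with hM
  set c : ℕ → ℕ := fun p => (W.minimalDiscriminantNorm ℤ).factorization p with hc
  have hT := hC W hsf hcard
  change ((∏ r ∈ M, c r : ℕ) : ℝ) ≤ C * (W.conductorNorm ℤ : ℝ) ^ ε at hT
  obtain ⟨p₀, hp₀⟩ := hne
  have hTpos : 0 < ∏ r ∈ M, c r := Finset.prod_pos fun r hr => hpos r hr
  have hdvd : d ∣ ∏ r ∈ M, c r := (hd p₀ hp₀).trans (Finset.dvd_prod_of_mem c hp₀)
  have hle : (d : ℝ) ≤ ((∏ r ∈ M, c r : ℕ) : ℝ) := by exact_mod_cast Nat.le_of_dvd hTpos hdvd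
  exact hle.trans hT

/-! ## The skeleton theorem -/

/-- **The decomposition, closed form (no sorry):** the four stub statements imply the crux, stated
with the crux unfolded (so that only `FewPrimeValuationProduct_of` concludes the route decl by name):
pair switching bound → fixed-level congruence → least distinguishing prime → small-prime depth →
crux. -/
theorem of_parts
    (h₁ : ∀ ε : ℝ, 0 < ε → ∃ K : ℝ, ∀ (W : WeierstrassCurve ℚ) [W.IsElliptic],
      (∀ p : ℕ, p.Prime → p ≠ 2 → ¬ p ^ 2 ∣ W.conductorNorm ℤ) →
      ((W.conductorNorm ℤ).primeFactors.filter
        (fun p => p ≠ 2 ∧ ¬ p ^ 2 ∣ W.conductorNorm ℤ)).card ≤ 3 →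
      (∀ p ∈ (W.conductorNorm ℤ).primeFactors.filter (fun p => ¬ p ^ 2 ∣ W.conductorNorm ℤ),
        0 < (W.minimalDiscriminantNorm ℤ).factorization p) →
      ∀ p ∈ (W.conductorNorm ℤ).primeFactors.filter (fun p => ¬ p ^ 2 ∣ W.conductorNorm ℤ),
      ∀ q ∈ (W.conductorNorm ℤ).primeFactors.filter (fun p => ¬ p ^ 2 ∣ W.conductorNorm ℤ),
        p ≠ q →
        (((W.minimalDiscriminantNorm ℤ).factorization p *
            (W.minimalDiscriminantNorm ℤ).factorization q : ℕ) : ℝ) ≤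
          K * (W.conductorNorm ℤ : ℝ) ^ ε *
            ((Nat.gcd ((W.minimalDiscriminantNorm ℤ).factorization p)
                ((W.minimalDiscriminantNorm ℤ).factorization q) ^ 2 : ℕ) : ℝ))
    (h₂ : ∃ ℓ₀ : ℕ, ∃ S : Finset (WeierstrassCurve ℚ),
      (∀ W₀ ∈ S, W₀.IsElliptic ∧ (∀ p ∈ (W₀.conductorNorm ℤ).primeFactors, p = 2) ∧
        2 ^ 2 ∣ W₀.conductorNorm ℤ) ∧
      ∀ (ℓ m : ℕ), ℓ.Prime → ℓ₀ ≤ ℓ → 1 ≤ m → ∀ (W : WeierstrassCurve ℚ) [W.IsElliptic],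
        (∀ p : ℕ, p.Prime → p ≠ 2 → ¬ p ^ 2 ∣ W.conductorNorm ℤ) →
        ((W.conductorNorm ℤ).primeFactors.filter
          (fun p => p ≠ 2 ∧ ¬ p ^ 2 ∣ W.conductorNorm ℤ)).card ≤ 3 →
        ((W.conductorNorm ℤ).primeFactors.filter (fun p => ¬ p ^ 2 ∣ W.conductorNorm ℤ)).Nonempty →
        (∀ p ∈ (W.conductorNorm ℤ).primeFactors.filter (fun p => ¬ p ^ 2 ∣ W.conductorNorm ℤ),
          0 < (W.minimalDiscriminantNorm ℤ).factorization p) →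
        (∀ p ∈ (W.conductorNorm ℤ).primeFactors.filter (fun p => ¬ p ^ 2 ∣ W.conductorNorm ℤ),
          ℓ ^ m ∣ (W.minimalDiscriminantNorm ℤ).factorization p) →
        ∃ W₀ ∈ S, ∀ v : ℕ, v.Prime → ¬ v ∣ 2 * W.conductorNorm ℤ →
          ((ℓ ^ m : ℕ) : ℤ) ∣ W.LFunction v - W₀.LFunction v)
    (h₃ : ∀ (W₀ : WeierstrassCurve ℚ) [W₀.IsElliptic],
      (∀ p ∈ (W₀.conductorNorm ℤ).primeFactors, p = 2) → 2 ^ 2 ∣ W₀.conductorNorm ℤ →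
      ∀ ε : ℝ, 0 < ε → ∃ C : ℝ, ∀ (W : WeierstrassCurve ℚ) [W.IsElliptic],
        (∀ p : ℕ, p.Prime → p ≠ 2 → ¬ p ^ 2 ∣ W.conductorNorm ℤ) →
        ((W.conductorNorm ℤ).primeFactors.filter
          (fun p => p ≠ 2 ∧ ¬ p ^ 2 ∣ W.conductorNorm ℤ)).card ≤ 3 →
        ((W.conductorNorm ℤ).primeFactors.filter (fun p => ¬ p ^ 2 ∣ W.conductorNorm ℤ)).Nonempty →
        ∃ v : ℕ, v.Prime ∧ ¬ v ∣ 2 * W.conductorNorm ℤ ∧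
          (v : ℝ) ≤ C * (W.conductorNorm ℤ : ℝ) ^ ε ∧ W.LFunction v ≠ W₀.LFunction v)
    (h₄ : ∀ ℓ : ℕ, ℓ.Prime → ∃ B : ℝ, ∀ (W : WeierstrassCurve ℚ) [W.IsElliptic],
      (∀ p : ℕ, p.Prime → p ≠ 2 → ¬ p ^ 2 ∣ W.conductorNorm ℤ) →
      ((W.conductorNorm ℤ).primeFactors.filter
        (fun p => p ≠ 2 ∧ ¬ p ^ 2 ∣ W.conductorNorm ℤ)).card ≤ 3 →
      ((W.conductorNorm ℤ).primeFactors.filter (fun p => ¬ p ^ 2 ∣ W.conductorNorm ℤ)).Nonempty →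
      (∀ p ∈ (W.conductorNorm ℤ).primeFactors.filter (fun p => ¬ p ^ 2 ∣ W.conductorNorm ℤ),
        0 < (W.minimalDiscriminantNorm ℤ).factorization p) →
      ∀ m : ℕ,
        (∀ p ∈ (W.conductorNorm ℤ).primeFactors.filter (fun p => ¬ p ^ 2 ∣ W.conductorNorm ℤ),
          ℓ ^ m ∣ (W.minimalDiscriminantNorm ℤ).factorization p) →
        ((ℓ ^ m : ℕ) : ℝ) ≤ B) :
    ∀ ε : ℝ, 0 < ε → ∃ C : ℝ, ∀ (W : WeierstrassCurve ℚ) [W.IsElliptic],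
      (∀ p : ℕ, p.Prime → p ≠ 2 → ¬ p ^ 2 ∣ W.conductorNorm ℤ) →
      ((W.conductorNorm ℤ).primeFactors.filter
        (fun p => p ≠ 2 ∧ ¬ p ^ 2 ∣ W.conductorNorm ℤ)).card ≤ 3 →
      ((∏ p ∈ (W.conductorNorm ℤ).primeFactors with ¬ p ^ 2 ∣ W.conductorNorm ℤ,
        (W.minimalDiscriminantNorm ℤ).factorization p : ℕ) : ℝ) ≤ C * (W.conductorNorm ℤ : ℝ) ^ ε :=
  fewPrime_of_pair_depth h₁ (depthBound_of h₂ h₃ h₄)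

/-- **Skeleton theorem**: the crux BY NAME from the four registered stubs
(pair switching bound, fixed-level congruence, least distinguishing prime, small-prime depth). -/
theorem FewPrimeValuationProduct_of :
    Summit.ABC.ABC.Theses.RibetTakahashiSplit.FewPrimeValuationProduct :=
  of_parts stub_pairSwitching stub_fixedLevelCongruence stub_leastDistinguishingPrime
    stub_smallPrimeDepth

end Summit.ABC.ABC.Cruxes.FewPrimeValuationProduct.HassePinningFixedLevel

end
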